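import Summits.Ventures.Crystal3D.Theorems.StickyWulffConstantGenericWallFloorRiserEndRows
import HarnessLib

/-!
# Two NON-ADJACENT holes in a cuboctahedral shell are jammed — census-free `ContactsAtMostOff` rows; two ADJACENT
# holes are not (the square-face pocket)   (crux `GenericWallFloor`, stmt-Ventures-19480, line `WallLedgerG`)

HONEST FRAMING. Venture `Summits/Ventures/Crystal3D` (cell `crystal3d-full`), helper `--supports` the crux
`GenericWallFloor` of `route-Ventures-StickyWulffConstant`, REGISTERED line `WallLedgerG`, open stub
`stub_twoSlabAdhesion`; residual of record `GenericWallFloorCore`.  Rung credit only; F-C1 not moved; NOT the crux.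
KERNEL PROOFS, no census input: the first rows of the riser-end format `ContactsAtMostOff`
(`…GenericWallFloorRiserEndRows`) that need no certificate.

Setting (integer model of the cuboctahedral shell: slots `fccInt`, `|u|² = 2`, «`⟨u, v⟩ ≤ 1`» = «the unit balls at
`u/√2` and `v/√2` around a common centre do not overlap»).  A ball `b` whose shell is EXACT except for two empty slots
`h₁, h₂`: where can a further contact of `b` sit?
* `twoHoles_antipodal` (`h₁, h₂` at 180°), `twoHoles_right` (90°), `twoHoles_obtuse` (120°): ONLY at `h₁` or `h₂` — the
  ten remaining slots jam every other position (linear belt inequalities `|uᵢ| + |uⱼ| ≤ 1` + the norm); `oneHole`: with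
  eleven exact slots the twelfth contact is AT the twelfth slot (census-free «eleven pin the twelfth»);
* `twoHoles_adjacent_pocket` (60°): NOT jammed — the explicit vector `(√(3/2), ½, ½)` is admissible and is neither hole
  (the pocket over the square face next to the hole edge, 31.5° from both holes; memo ROW-G2H-SPEC §2(a)).  So the
  riser-end rows with two ADJACENT in-plane holes (`RiserEnd_E1_*`) genuinely need their obstacle balls (engine rows),
  while non-adjacent hole pairs need nothing;
* `contactsAtMostOff_of_model` — any model pair lemma of this shape gives, for EVERY frame `A` and centre `b`, the row
  `ContactsAtMostOff b {b + A v/√2 : v ≠ h₁, h₂} {b + A h₁/√2, b + A h₂/√2} 10` (ten exact contacts present, both hole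
  sites empty ⇒ at most ten contacts), by pulling a contact back to the model (`u = √2·A⁻¹(y − b)`,
  `1 ≤ dist ⇒ ⟨u, v⟩ ≤ 1`); instances **`contactsAtMostOff_twoHoles_antipodal / _right / _obtuse`**.  Up to the
  cuboctahedral symmetry (a lattice isometry, cf. `exists_latticeIso_map_slot`) these are ALL non-adjacent pairs; a
  consumer meets another pair by re-choosing the frame `A`.
USE (lane G core, 19480-p2 g5 08:22Z (3) «shared-defect ½»): a ball that is the certified end of two words with two
DIFFERENT empty forward slots at ≥ 90° — e.g. an up-hole and a down-hole at a common-layer ball of a twin riser, or the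
two ends of a cross-grain double top — has at most ten contacts, i.e. PAYS 2, census-free; only the adjacent (60°) case
needs a certified row.

WHAT THIS IS NOT: no statement about adjacent holes beyond the counterexample; no census; F-C1 not moved.
-/

noncomputable section

namespace Summit.Ventures.Crystal3D.Theorems

open Finset Literature.Geometry.DiscreteGeometry
open scoped RealInnerProductSpace

/-- Integer-scale model (`|x|² = 2`, slots = `fccInt`), ANTIPODAL hole pair `(1,1,0)`, `(−1,−1,0)`: a vector of squared
norm `2` with `⟨x, v⟩ ≤ 1` for the ten other slots `v` is one of the two holes. -/
theorem twoHoles_antipodal (a b c : ℝ) (hn : a ^ 2 + b ^ 2 + c ^ 2 = 2)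
    (h : ∀ v ∈ fccInt, v ≠ ![1, 1, 0] → v ≠ ![-1, -1, 0] → a * v 0 + b * v 1 + c * v 2 ≤ 1) :
    (a = 1 ∧ b = 1 ∧ c = 0) ∨ (a = -1 ∧ b = -1 ∧ c = 0) := by
  have h1 := h ![1, 0, 1] (by decide) (by decide) (by decide)
  have h2 := h ![1, 0, -1] (by decide) (by decide) (by decide)
  have h3 := h ![-1, 0, 1] (by decide) (by decide) (by decide)
  have h4 := h ![-1, 0, -1] (by decide) (by decide) (by decide)
  have h5 := h ![0, 1, 1] (by decide) (by decide) (by decide)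
  have h6 := h ![0, 1, -1] (by decide) (by decide) (by decide)
  have h7 := h ![0, -1, 1] (by decide) (by decide) (by decide)
  have h8 := h ![0, -1, -1] (by decide) (by decide) (by decide)
  have h9 := h ![1, -1, 0] (by decide) (by decide) (by decide)
  have h10 := h ![-1, 1, 0] (by decide) (by decide) (by decide)
  simp only [Matrix.cons_val_zero, Matrix.cons_val_one, Matrix.head_cons, Matrix.cons_val_two, Matrix.tail_cons,
    Int.cast_one, Int.cast_zero, Int.cast_neg, mul_one, mul_zero, mul_neg, add_zero, zero_add] at h1 h2 h3 h4 h5 h6 h7 h8 h9 h10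
  -- |a| + |c| ≤ 1 and |b| + |c| ≤ 1 force c = 0
  have hc : c = 0 := by
    rcases le_total 0 c with hc | hc <;> rcases le_total 0 a with ha | ha <;> rcases le_total 0 b with hb | hb <;> nlinarith
  subst hc
  have ha : a ^ 2 = 1 := by nlinarith
  have hb : b ^ 2 = 1 := by nlinarith
  have ha' : a = 1 ∨ a = -1 := by
    rcases mul_eq_zero.1 (show (a - 1) * (a + 1) = 0 by nlinarith) with h | h
    · exact Or.inl (by linarith)
    · exact Or.inr (by linarith)
  have hb' : b = 1 ∨ b = -1 := by
    rcases mul_eq_zero.1 (show (b - 1) * (b + 1) = 0 by nlinarith) with h | h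
    · exact Or.inl (by linarith)
    · exact Or.inr (by linarith)
  rcases ha' with rfl | rfl <;> rcases hb' with rfl | rfl
  · exact Or.inl ⟨rfl, rfl, rfl⟩
  · norm_num at h9
  · norm_num at h10
  · exact Or.inr ⟨rfl, rfl, rfl⟩

/-- RIGHT-ANGLE hole pair `(1,1,0)`, `(1,−1,0)` (90° apart): same conclusion. -/
theorem twoHoles_right (a b c : ℝ) (hn : a ^ 2 + b ^ 2 + c ^ 2 = 2)
    (h : ∀ v ∈ fccInt, v ≠ ![1, 1, 0] → v ≠ ![1, -1, 0] → a * v 0 + b * v 1 + c * v 2 ≤ 1) :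
    (a = 1 ∧ b = 1 ∧ c = 0) ∨ (a = 1 ∧ b = -1 ∧ c = 0) := by
  have h1 := h ![1, 0, 1] (by decide) (by decide) (by decide)
  have h2 := h ![1, 0, -1] (by decide) (by decide) (by decide)
  have h3 := h ![-1, 0, 1] (by decide) (by decide) (by decide)
  have h4 := h ![-1, 0, -1] (by decide) (by decide) (by decide)
  have h5 := h ![0, 1, 1] (by decide) (by decide) (by decide)
  have h6 := h ![0, 1, -1] (by decide) (by decide) (by decide)
  have h7 := h ![0, -1, 1] (by decide) (by decide) (by decide)
  have h8 := h ![0, -1, -1] (by decide) (by decide) (by decide)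
  have h9 := h ![-1, -1, 0] (by decide) (by decide) (by decide)
  have h10 := h ![-1, 1, 0] (by decide) (by decide) (by decide)
  simp only [Matrix.cons_val_zero, Matrix.cons_val_one, Matrix.head_cons, Matrix.cons_val_two, Matrix.tail_cons,
    Int.cast_one, Int.cast_zero, Int.cast_neg, mul_one, mul_zero, mul_neg, add_zero, zero_add] at h1 h2 h3 h4 h5 h6 h7 h8 h9 h10
  have hc : c = 0 := by
    rcases le_total 0 c with hc | hc <;> rcases le_total 0 a with ha | ha <;> rcases le_total 0 b with hb | hb <;> nlinarith
  subst hc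
  have ha' : a = 1 ∨ a = -1 := by
    rcases mul_eq_zero.1 (show (a - 1) * (a + 1) = 0 by nlinarith) with h | h
    · exact Or.inl (by linarith)
    · exact Or.inr (by linarith)
  have hb' : b = 1 ∨ b = -1 := by
    rcases mul_eq_zero.1 (show (b - 1) * (b + 1) = 0 by nlinarith) with h | h
    · exact Or.inl (by linarith)
    · exact Or.inr (by linarith)
  rcases ha' with rfl | rfl <;> rcases hb' with rfl | rfl
  · exact Or.inl ⟨rfl, rfl, rfl⟩
  · exact Or.inr ⟨rfl, rfl, rfl⟩
  · norm_num at h10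
  · norm_num at h9

/-- OBTUSE hole pair `(1,1,0)`, `(−1,0,1)` (120° apart): same conclusion. -/
theorem twoHoles_obtuse (a b c : ℝ) (hn : a ^ 2 + b ^ 2 + c ^ 2 = 2)
    (h : ∀ v ∈ fccInt, v ≠ ![1, 1, 0] → v ≠ ![-1, 0, 1] → a * v 0 + b * v 1 + c * v 2 ≤ 1) :
    (a = 1 ∧ b = 1 ∧ c = 0) ∨ (a = -1 ∧ b = 0 ∧ c = 1) := by
  have h1 := h ![1, 0, 1] (by decide) (by decide) (by decide)
  have h2 := h ![1, 0, -1] (by decide) (by decide) (by decide)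
  have h4 := h ![-1, 0, -1] (by decide) (by decide) (by decide)
  have h5 := h ![0, 1, 1] (by decide) (by decide) (by decide)
  have h6 := h ![0, 1, -1] (by decide) (by decide) (by decide)
  have h7 := h ![0, -1, 1] (by decide) (by decide) (by decide)
  have h8 := h ![0, -1, -1] (by decide) (by decide) (by decide)
  have h9 := h ![1, -1, 0] (by decide) (by decide) (by decide)
  have h10 := h ![-1, 1, 0] (by decide) (by decide) (by decide)
  have h11 := h ![-1, -1, 0] (by decide) (by decide) (by decide)
  simp only [Matrix.cons_val_zero, Matrix.cons_val_one, Matrix.head_cons, Matrix.cons_val_two, Matrix.tail_cons,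
    Int.cast_one, Int.cast_zero, Int.cast_neg, mul_one, mul_zero, mul_neg, add_zero, zero_add] at h1 h2 h4 h5 h6 h7 h8 h9 h10 h11
  -- |b| + |c| ≤ 1 gives a² ≥ 1
  have hbc : b ^ 2 + c ^ 2 ≤ 1 := by
    rcases le_total 0 b with hb | hb <;> rcases le_total 0 c with hc | hc <;> nlinarith
  have ha2 : 1 ≤ a ^ 2 := by nlinarith
  rcases le_total 0 a with ha | ha
  · -- a ≥ 1: then c = 0, a = 1, b = 1
    have ha1 : 1 ≤ a := by nlinarith
    have hc : c = 0 := by nlinarith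
    have ha' : a = 1 := by nlinarith
    subst hc; subst ha'
    have hb : b = 1 := by nlinarith
    exact Or.inl ⟨rfl, hb, rfl⟩
  · -- a ≤ −1: then b = 0, a = −1, c = 1
    have ha1 : a ≤ -1 := by nlinarith
    have hb0 : b = 0 := by nlinarith
    have ha' : a = -1 := by nlinarith
    subst hb0; subst ha'
    have hc : c = 1 := by nlinarith
    exact Or.inr ⟨rfl, rfl, hc⟩

/-- ONE hole `(1,1,0)`: a vector of squared norm `2` with `⟨x, v⟩ ≤ 1` for the eleven other slots IS the hole
(census-free form of «eleven exact contacts pin the twelfth»). -/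
theorem oneHole (a b c : ℝ) (hn : a ^ 2 + b ^ 2 + c ^ 2 = 2)
    (h : ∀ v ∈ fccInt, v ≠ ![1, 1, 0] → a * v 0 + b * v 1 + c * v 2 ≤ 1) :
    a = 1 ∧ b = 1 ∧ c = 0 := by
  rcases twoHoles_antipodal a b c hn (fun v hv h1 _ => h v hv h1) with h' | ⟨rfl, rfl, rfl⟩
  · exact h'
  · exfalso
    have h12 := h ![-1, -1, 0] (by decide) (by decide)
    simp only [Matrix.cons_val_zero, Matrix.cons_val_one, Matrix.head_cons, Matrix.cons_val_two, Matrix.tail_cons,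
      Int.cast_one, Int.cast_zero, Int.cast_neg, mul_one, mul_zero, mul_neg, add_zero] at h12
    linarith

/-- ADJACENT holes are NOT jammed (the square-face pocket): for the hole pair `(1,1,0)`, `(1,0,1)` (60° apart) the
vector `(√(3/2), ½, ½)` has squared norm `2`, satisfies `⟨x, v⟩ ≤ 1` for the ten other slots, and is neither hole. -/
theorem twoHoles_adjacent_pocket :
    ∃ a b c : ℝ, a ^ 2 + b ^ 2 + c ^ 2 = 2 ∧
      (∀ v ∈ fccInt, v ≠ ![1, 1, 0] → v ≠ ![1, 0, 1] → a * v 0 + b * v 1 + c * v 2 ≤ 1) ∧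
      ¬ (a = 1 ∧ b = 1 ∧ c = 0) ∧ ¬ (a = 1 ∧ b = 0 ∧ c = 1) := by
  have hs : Real.sqrt (3 / 2) ^ 2 = 3 / 2 := Real.sq_sqrt (by norm_num)
  have hs0 : 0 ≤ Real.sqrt (3 / 2) := Real.sqrt_nonneg _
  have hs1 : Real.sqrt (3 / 2) ≤ 3 / 2 := by nlinarith
  refine ⟨Real.sqrt (3 / 2), 1 / 2, 1 / 2, by nlinarith, ?_, ?_, ?_⟩
  · intro v hv h1 h2
    simp only [fccInt, Finset.mem_insert, Finset.mem_singleton] at hv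
    rcases hv with rfl | rfl | rfl | rfl | rfl | rfl | rfl | rfl | rfl | rfl | rfl | rfl <;>
      first
        | exact absurd rfl h1
        | exact absurd rfl h2
        | (simp only [Matrix.cons_val_zero, Matrix.cons_val_one, Matrix.head_cons, Matrix.cons_val_two,
            Matrix.tail_cons, Int.cast_one, Int.cast_zero, Int.cast_neg, mul_one, mul_zero, mul_neg, add_zero,
            zero_add]; nlinarith)
  · rintro ⟨h, -, -⟩
    rw [h] at hs; norm_num at hs
  · rintro ⟨h, -, -⟩
    rw [h] at hs; norm_num at hs

/-! ### From the model lemmas to census-free `ContactsAtMostOff` rows in any frame -/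

/-- **Census-free two-hole row from a model rigidity lemma.**  Let `h₁ ≠ h₂` be two slots (integer model) for which
the model statement «`|u|² = 2` and `⟨u, v⟩ ≤ 1` for every other slot `v` force `u ∈ {h₁, h₂}`» holds.  Then for every
frame `A` and centre `b`: with the ten balls `b + A v/√2` (`v ≠ h₁, h₂`) present and the two hole sites empty, `b` has at
most ten contacts — `ContactsAtMostOff` of `…GenericWallFloorRiserEndRows`, PROVED (no certificate). -/
theorem contactsAtMostOff_of_model (h₁ h₂ : Fin 3 → ℤ) (hh₁ : h₁ ∈ fccInt) (hh₂ : h₂ ∈ fccInt) (hne : h₁ ≠ h₂)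
    (hmodel : ∀ a b c : ℝ, a ^ 2 + b ^ 2 + c ^ 2 = 2 →
      (∀ v ∈ fccInt, v ≠ h₁ → v ≠ h₂ → a * v 0 + b * v 1 + c * v 2 ≤ 1) →
      (a = h₁ 0 ∧ b = h₁ 1 ∧ c = h₁ 2) ∨ (a = h₂ 0 ∧ b = h₂ 1 ∧ c = h₂ 2))
    (A : EuclideanSpace ℝ (Fin 3) ≃ₗᵢ[ℝ] EuclideanSpace ℝ (Fin 3)) (b : EuclideanSpace ℝ (Fin 3)) :
    ContactsAtMostOff b (((fccInt.erase h₁).erase h₂).image fun v => b + (Real.sqrt 2)⁻¹ • A (intVec v))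
      (({h₁, h₂} : Finset (Fin 3 → ℤ)).image fun v => b + (Real.sqrt 2)⁻¹ • A (intVec v)) 10 := by
  classical
  intro X hX hF hH
  have hs0 : 0 < Real.sqrt 2 := by positivity
  have hs2 : Real.sqrt 2 ^ 2 = 2 := Real.sq_sqrt (by norm_num)
  -- every contact of `b` in `X` is one of the ten present slot balls
  have hsub : (X.filter fun q => dist b q = 1) ⊆
      ((fccInt.erase h₁).erase h₂).image fun v => b + (Real.sqrt 2)⁻¹ • A (intVec v) := by
    intro y hy
    rw [Finset.mem_filter] at hy
    obtain ⟨hyX, hyd⟩ := hy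
    by_contra hyF
    set u : EuclideanSpace ℝ (Fin 3) := Real.sqrt 2 • A.symm (y - b) with hu
    have hyb : ‖y - b‖ = 1 := by rw [← dist_eq_norm, dist_comm]; exact hyd
    have hun : ‖u‖ ^ 2 = 2 := by
      rw [hu, norm_smul, Real.norm_of_nonneg hs0.le, LinearIsometryEquiv.norm_map, hyb, mul_one, hs2]
    have hcoord : u 0 ^ 2 + u 1 ^ 2 + u 2 ^ 2 = 2 := by
      have h := hun
      rw [EuclideanSpace.norm_eq, Real.sq_sqrt (Finset.sum_nonneg fun i _ => sq_nonneg _), Fin.sum_univ_three] at h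
      simpa only [Real.norm_eq_abs, sq_abs] using h
    have hineq : ∀ v ∈ fccInt, v ≠ h₁ → v ≠ h₂ → u 0 * v 0 + u 1 * v 1 + u 2 * v 2 ≤ 1 := by
      intro v hv hv1 hv2
      have hpF : b + (Real.sqrt 2)⁻¹ • A (intVec v) ∈
          ((fccInt.erase h₁).erase h₂).image fun v => b + (Real.sqrt 2)⁻¹ • A (intVec v) :=
        Finset.mem_image_of_mem _ (Finset.mem_erase.2 ⟨hv2, Finset.mem_erase.2 ⟨hv1, hv⟩⟩)
      have hneq : y ≠ b + (Real.sqrt 2)⁻¹ • A (intVec v) := fun e => hyF (e ▸ hpF)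
      have hd := hX y hyX _ (hF hpF) hneq
      have hvec : y - (b + (Real.sqrt 2)⁻¹ • A (intVec v)) = A ((Real.sqrt 2)⁻¹ • (u - intVec v)) := by
        rw [hu, smul_sub, smul_smul, inv_mul_cancel₀ hs0.ne', one_smul, map_sub, map_smul,
          LinearIsometryEquiv.apply_symm_apply]
        abel
      have hdist : dist y (b + (Real.sqrt 2)⁻¹ • A (intVec v)) = (Real.sqrt 2)⁻¹ * ‖u - intVec v‖ := by
        rw [dist_eq_norm, hvec, LinearIsometryEquiv.norm_map, norm_smul, Real.norm_of_nonneg (inv_nonneg.2 hs0.le)]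
      rw [hdist] at hd
      have hnorm : Real.sqrt 2 ≤ ‖u - intVec v‖ := by
        have := mul_le_mul_of_nonneg_left hd hs0.le
        rwa [mul_one, ← mul_assoc, mul_inv_cancel₀ hs0.ne', one_mul] at this
      have hsq : 2 ≤ ‖u - intVec v‖ ^ 2 := by nlinarith [norm_nonneg (u - intVec v)]
      have hv2 : (sqNormInt v : ℝ) = 2 := by exact_mod_cast sqNormInt_fccInt v hv
      have hw : ‖intVec v‖ ^ 2 = 2 := by
        rw [norm_intVec, Real.sq_sqrt (by rw [hv2]; norm_num), hv2]
      have hinner : ⟪u, intVec v⟫ = u 0 * v 0 + u 1 * v 1 + u 2 * v 2 := by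
        simp [intVec, PiLp.inner_apply, Fin.sum_univ_three, mul_comm]
      rw [norm_sub_sq_real, hun, hw, hinner] at hsq
      linarith
    have key : ∀ w : Fin 3 → ℤ, w ∈ ({h₁, h₂} : Finset (Fin 3 → ℤ)) →
        u 0 = w 0 ∧ u 1 = w 1 ∧ u 2 = w 2 → False := by
      rintro w hw ⟨e0, e1, e2⟩
      have hueq : u = intVec w := by
        ext i; fin_cases i
        · simpa using e0
        · simpa using e1
        · simpa using e2
      have hsymm : A.symm (y - b) = (Real.sqrt 2)⁻¹ • u := by
        rw [hu, smul_smul, inv_mul_cancel₀ hs0.ne', one_smul]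
      have hy' : y = b + (Real.sqrt 2)⁻¹ • A (intVec w) := by
        have : y - b = (Real.sqrt 2)⁻¹ • A (intVec w) := by
          rw [← LinearIsometryEquiv.apply_symm_apply A (y - b), hsymm, map_smul, hueq]
        rw [← this]; abel
      exact hH _ (Finset.mem_image_of_mem _ hw) (hy' ▸ hyX)
    rcases hmodel (u 0) (u 1) (u 2) hcoord hineq with hc | hc
    · exact key h₁ (by simp) hc
    · exact key h₂ (by simp) hc
  calc (X.filter fun q => dist b q = 1).card
      ≤ (((fccInt.erase h₁).erase h₂).image fun v => b + (Real.sqrt 2)⁻¹ • A (intVec v)).card :=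
        Finset.card_le_card hsub
    _ ≤ ((fccInt.erase h₁).erase h₂).card := Finset.card_image_le
    _ = 10 := by
        rw [Finset.card_erase_of_mem (Finset.mem_erase.2 ⟨hne.symm, hh₂⟩), Finset.card_erase_of_mem hh₁,
          card_fccInt]

/-- **Antipodal holes, any frame** (`180°`): census-free `ContactsAtMostOff … 10`. -/
theorem contactsAtMostOff_twoHoles_antipodal
    (A : EuclideanSpace ℝ (Fin 3) ≃ₗᵢ[ℝ] EuclideanSpace ℝ (Fin 3)) (b : EuclideanSpace ℝ (Fin 3)) :
    ContactsAtMostOff b (((fccInt.erase ![1, 1, 0]).erase ![-1, -1, 0]).image fun v => b + (Real.sqrt 2)⁻¹ • A (intVec v))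
      (({![1, 1, 0], ![-1, -1, 0]} : Finset (Fin 3 → ℤ)).image fun v => b + (Real.sqrt 2)⁻¹ • A (intVec v)) 10 := by
  refine contactsAtMostOff_of_model _ _ (by decide) (by decide) (by decide) (fun a b c hn h => ?_) A b
  rcases twoHoles_antipodal a b c hn h with ⟨rfl, rfl, rfl⟩ | ⟨rfl, rfl, rfl⟩
  · left; simp
  · right; simp

/-- **Holes at right angles, any frame** (`90°`): census-free `ContactsAtMostOff … 10`. -/
theorem contactsAtMostOff_twoHoles_right
    (A : EuclideanSpace ℝ (Fin 3) ≃ₗᵢ[ℝ] EuclideanSpace ℝ (Fin 3)) (b : EuclideanSpace ℝ (Fin 3)) :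
    ContactsAtMostOff b (((fccInt.erase ![1, 1, 0]).erase ![1, -1, 0]).image fun v => b + (Real.sqrt 2)⁻¹ • A (intVec v))
      (({![1, 1, 0], ![1, -1, 0]} : Finset (Fin 3 → ℤ)).image fun v => b + (Real.sqrt 2)⁻¹ • A (intVec v)) 10 := by
  refine contactsAtMostOff_of_model _ _ (by decide) (by decide) (by decide) (fun a b c hn h => ?_) A b
  rcases twoHoles_right a b c hn h with ⟨rfl, rfl, rfl⟩ | ⟨rfl, rfl, rfl⟩
  · left; simp
  · right; simp

/-- **Obtuse holes, any frame** (`120°`): census-free `ContactsAtMostOff … 10`. -/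
theorem contactsAtMostOff_twoHoles_obtuse
    (A : EuclideanSpace ℝ (Fin 3) ≃ₗᵢ[ℝ] EuclideanSpace ℝ (Fin 3)) (b : EuclideanSpace ℝ (Fin 3)) :
    ContactsAtMostOff b (((fccInt.erase ![1, 1, 0]).erase ![-1, 0, 1]).image fun v => b + (Real.sqrt 2)⁻¹ • A (intVec v))
      (({![1, 1, 0], ![-1, 0, 1]} : Finset (Fin 3 → ℤ)).image fun v => b + (Real.sqrt 2)⁻¹ • A (intVec v)) 10 := by
  refine contactsAtMostOff_of_model _ _ (by decide) (by decide) (by decide) (fun a b c hn h => ?_) A b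
  rcases twoHoles_obtuse a b c hn h with ⟨rfl, rfl, rfl⟩ | ⟨rfl, rfl, rfl⟩
  · left; simp
  · right; simp

end Summit.Ventures.Crystal3D.Theorems

end
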